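import Summits.ResolutionOfSingularities.ResolutionOfSingularities.Theorems.FrobeniusLadderFInjectiveMacaulayficationCNCylinder
import Summits.ResolutionOfSingularities.ResolutionOfSingularities.Theorems.FrobeniusLadderFInjectiveMacaulayficationCNCylinderAxis
import Summits.ResolutionOfSingularities.ResolutionOfSingularities.Theorems.FrobeniusLadderFInjectiveMacaulayficationQ6CNData
import Summits.ResolutionOfSingularities.ResolutionOfSingularities.Theorems.FrobeniusLadderFInjectiveMacaulayficationQ6CNCharts
import Summits.ResolutionOfSingularities.ResolutionOfSingularities.Theorems.FrobeniusLadderFInjectiveMacaulayficationQ6CNCover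
import Summits.ResolutionOfSingularities.ResolutionOfSingularities.Theorems.FrobeniusLadderFInjectiveMacaulayficationQ6CNFaceSelectA
import Summits.ResolutionOfSingularities.ResolutionOfSingularities.Theorems.FrobeniusLadderFInjectiveMacaulayficationQ6CNFaceSelectB
import Summits.ResolutionOfSingularities.ResolutionOfSingularities.Theorems.FrobeniusLadderFInjectiveMacaulayficationQ6CNFaceSelectC
import Summits.ResolutionOfSingularities.ResolutionOfSingularities.Theorems.FrobeniusLadderFInjectiveMacaulayficationQ6CNFaceSelectD
import Summits.ResolutionOfSingularities.ResolutionOfSingularities.Theorems.FrobeniusLadderFInjectiveMacaulayficationQ6CNFaceSelectE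
import Summits.ResolutionOfSingularities.ResolutionOfSingularities.Theorems.FrobeniusLadderFInjectiveMacaulayficationQ6Prime
import Summits.ResolutionOfSingularities.ResolutionOfSingularities.Theorems.FrobeniusLadderFInjectiveMacaulayficationQ6LineOffAxis
import HarnessLib

/-!
# Q6-LINE: the first crux instance with a NON-ISOLATED bad locus — a STRONG⁺ confined iso-step for `V(f₂) × 𝔸¹ ⊂ 𝔸⁴` over every
# field of characteristic `5`, at the generic point of its axis (crux `FInjectiveMacaulayfication` stmt-ResolutionOfSingularities-15315,
# chain w45a, hole #3; CRUX-PLAN v7 R7.5 (iv) / v8 §5 / R9.2 «Q6-LINE := strongPlusStep_cylinder_of_cnData at stub-3's named Q6 binders»)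

Support file for crux stmt-ResolutionOfSingularities-15315 (`FrobeniusLadder.FInjectiveMacaulayfication`), chain w45a, seat
res-D-pv-017 AS res-L1-w45a-stub-5. [OURS · L1 W4.5a] — NOT a statement of any manuscript; AI-written, weaker than expert review.

`f₂ = x³y³ + x³z³ + y³z³ + z⁶ + x⁸ + y⁸` (idea-2's specimen Q6; data of record `Q6-fan.json` 4c41e681b86ed32f, typed by res-L1-w45a-stub-3 as
`Q6CNData` / `Q6CNCharts` / `Q6CNCover` / `Q6CNFaceSelectA–E`, primality `Q6Prime`, off-axis clause `Q6LineOffAxis` by res-D-pv-019 AS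
stub-7). The cylinder `X₁ = Spec k[X₀,…,X₃]/(f₂(X₁,X₂,X₃))` is bad exactly along the axis `V(x̄₁,x̄₂,x̄₃)` (a line); its generic point
`η` is a NON-CLOSED bad point all of whose proper generizations are good — the situation of the registered hole-#3 stub
`stub_confinedIsoStepStrongPlus`. THEOREM (`q6Line_strongPlusStep`): the ∃-clause of that stub VERBATIM at `η` — the blow-up of the
monomial ideal `I_A·k[X]` (A = the 108 exponents of Q6 shifted off `X₀`, plus the 15 redundant `x^{m_c}X₀`) is proper, birational,
integral, everywhere Cohen–Macaulay, an isomorphism exactly off `closure {η}`, with CM-domain stalks having Frobenius-closed parameter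
ideals over `closure {η}`. `q6Line_exists_axisPoint`: `η` exists. One-screen instantiation of `CNCylinder.strongPlusStep_cylinder_of_cnData`
(p503342). No definitions, no named facts, no new data. [folklore]
-/

-- single-problem summit: the doubled namespace component is forced
set_option linter.dupNamespace false

noncomputable section

open AlgebraicGeometry CategoryTheory Literature.AlgebraicGeometry.Resolution MvPolynomial

namespace Summit.ResolutionOfSingularities.ResolutionOfSingularities.Theorems.FInjectiveMacaulayfication.Q6LineStrongPlusStep

open Summit.ResolutionOfSingularities.ResolutionOfSingularities.Theorems.FInjectiveMacaulayfication

/-- The generic point of the axis `V(x̄₁,x̄₂,x̄₃)` of the Q6 cylinder exists (`f₂` has no constant term). [folklore] -/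
theorem q6Line_exists_axisPoint (k : Type) [Field k] [CharP k 5] (f : MvPolynomial (Fin 3) k)
    (hf : f = MvPolynomial.X 0 ^ 3 * MvPolynomial.X 1 ^ 3 + MvPolynomial.X 0 ^ 3 * MvPolynomial.X 2 ^ 3 +
        MvPolynomial.X 1 ^ 3 * MvPolynomial.X 2 ^ 3 + MvPolynomial.X 2 ^ 6 + MvPolynomial.X 0 ^ 8 + MvPolynomial.X 1 ^ 8) :
    ∃ η : ↥(Spec (.of (MvPolynomial (Fin 4) k ⧸ Ideal.span {rename Fin.succ f}))),
      η.asIdeal = Ideal.span (Set.range fun j : Fin 3 => Ideal.Quotient.mk (Ideal.span {rename Fin.succ f}) (X j.succ)) :=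
  CNCylinder.exists_axisPoint f (by subst hf; simp [constantCoeff_X])

set_option maxHeartbeats 1600000 in
/-- **Q6-LINE — a STRONG⁺ confined iso-step at the generic point of the axis of `V(f₂) × 𝔸¹` (char 5)**: the ∃-clause of
`stub_confinedIsoStepStrongPlus` VERBATIM for `X₁ = Spec k[X_{Fin 4}]/(rename Fin.succ f₂)` and every `η` with `η.asIdeal = (x̄₁,x̄₂,x̄₃)`
(such `η` exists: `q6Line_exists_axisPoint`). Proof: `CNCylinder.strongPlusStep_cylinder_of_cnData` at stub-3's Q6 binders
(`Q6CNData.q6_hA0 … q6_hge`, `Q6CNCover.q6_hcov`, `Q6CNCharts.q6_hg/q6_hndiv/q6_hface`, `Q6CNFaceSelectA–E.hCN_0 … hCN_14`,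
`Q6Prime.q6_isPrime / q6_X_ne_zero`) and stub-7's `Q6LineOffAxis.q6Line_offAxis_clause_char5'`. [folklore] -/
theorem q6Line_strongPlusStep (k : Type) [Field k] [CharP k 5] (f : MvPolynomial (Fin 3) k)
    (hf : f = MvPolynomial.X 0 ^ 3 * MvPolynomial.X 1 ^ 3 + MvPolynomial.X 0 ^ 3 * MvPolynomial.X 2 ^ 3 +
        MvPolynomial.X 1 ^ 3 * MvPolynomial.X 2 ^ 3 + MvPolynomial.X 2 ^ 6 + MvPolynomial.X 0 ^ 8 + MvPolynomial.X 1 ^ 8)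
    (η : ↥(Spec (.of (MvPolynomial (Fin 4) k ⧸ Ideal.span {rename Fin.succ f}))))
    (hη : η.asIdeal = Ideal.span (Set.range fun j : Fin 3 => Ideal.Quotient.mk (Ideal.span {rename Fin.succ f}) (X j.succ))) :
    ∃ (X₂ : Scheme.{0}) (π : X₂ ⟶ Spec (.of (MvPolynomial (Fin 4) k ⧸ Ideal.span {rename Fin.succ f}))), IsProper π ∧
      Literature.AlgebraicGeometry.Resolution.IsBirational π ∧
      IsIntegral X₂ ∧ (∀ x : X₂, (∀ d : ℕ, ringKrullDim (X₂.presheaf.stalk x) = d → ∀ s : Fin d → X₂.presheaf.stalk x, (Ideal.span (Set.range s)).radical.IsMaximal → RingTheory.Sequence.IsWeaklyRegular (X₂.presheaf.stalk x) (List.ofFn s))) ∧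
      IsIso (π ∣_ ⟨(closure ({η} : Set ↥(Spec (.of (MvPolynomial (Fin 4) k ⧸ Ideal.span {rename Fin.succ f})))))ᶜ, isClosed_closure.isOpen_compl⟩) ∧
      ∀ x : X₂, π.base x ∈ closure ({η} : Set ↥(Spec (.of (MvPolynomial (Fin 4) k ⧸ Ideal.span {rename Fin.succ f})))) → ¬ IsClosed ({x} : Set X₂) → (IsDomain (X₂.presheaf.stalk x) ∧ ∀ d : ℕ, ringKrullDim (X₂.presheaf.stalk x) = d → ∀ s : Fin d → X₂.presheaf.stalk x, (Ideal.span (Set.range s)).radical.IsMaximal → RingTheory.Sequence.IsWeaklyRegular (X₂.presheaf.stalk x) (List.ofFn s) ∧ ∀ t : X₂.presheaf.stalk x, (∃ e : ℕ, t ^ 5 ^ e ∈ Ideal.span ((fun z : X₂.presheaf.stalk x => z ^ 5 ^ e) '' (Ideal.span (Set.range s) : Set (X₂.presheaf.stalk x)))) → t ∈ Ideal.span (Set.range s)) := by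
  haveI : Fact (Nat.Prime 5) := ⟨by norm_num⟩
  refine CNCylinder.strongPlusStep_cylinder_of_cnData 5 k 3 (by norm_num) _ Q6CNData.q6_hA0 Q6CNData.q6_hprim 15 (by norm_num) _
    Q6CNData.q6_hV _ Q6CNData.q6_hm _ Q6CNData.q6_ha Q6CNData.q6_hgen Q6CNData.q6_hge Q6CNCover.q6_hcov f (Q6Prime.q6_isPrime f hf)
    (Q6Prime.q6_X_ne_zero f hf) ?_ _ _ (Q6CNCharts.q6_hg f hf) Q6CNCharts.q6_hndiv (Q6CNCharts.q6_hface f hf)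
    (Q6LineOffAxis.q6Line_offAxis_clause_char5' k f hf (rename Fin.succ f) rfl) η hη
  -- the Cartier–Newton faces, chart by chart (stub-3's `hCN_0 … hCN_14`)
  intro c
  fin_cases c
  exacts [Q6CNFaceSelectA.hCN_0 f hf, Q6CNFaceSelectA.hCN_1 f hf, Q6CNFaceSelectA.hCN_2 f hf, Q6CNFaceSelectB.hCN_3 f hf,
    Q6CNFaceSelectB.hCN_4 f hf, Q6CNFaceSelectB.hCN_5 f hf, Q6CNFaceSelectC.hCN_6 f hf, Q6CNFaceSelectC.hCN_7 f hf,
    Q6CNFaceSelectC.hCN_8 f hf, Q6CNFaceSelectD.hCN_9 f hf, Q6CNFaceSelectD.hCN_10 f hf, Q6CNFaceSelectD.hCN_11 f hf,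
    Q6CNFaceSelectE.hCN_12 f hf, Q6CNFaceSelectE.hCN_13 f hf, Q6CNFaceSelectE.hCN_14 f hf]

end Summit.ResolutionOfSingularities.ResolutionOfSingularities.Theorems.FInjectiveMacaulayfication.Q6LineStrongPlusStep

end
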